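import Summits.QuantumFields.YangMills.Theorems.BalabanUVNodesN11FibreChartSocketRecoordinatisation
import Literature.Probability.Distributions.GaussianPiDensity

/-!
# DAG node N11 — `⊗_b coordMeasure` UNFOLDED: Lebesgue on the product alcove with the product Haar density (ME #37 step S1 in LEBESGUE coordinates)

HEADER — WORK-UNIT METADATA.  Cell `pub-ymgap`, YM-PLAN Track A (HUMAN RULING D-0062 ∕ D-0149), WIDTH SEAT `pub-ymgap-dag-n11-w2` (g3) on node
N11 [B14]; route `BalabanUVNodes`, key item K1⁷ `StabilityBAtRecordR13SepCoPH` = stmt-QuantumFields-20542 (helper, `--kind proof --supports 20542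
--as helper`, count-neutral).  [16] = [Balaban1985UV3].  Sequel of FILE 4 `…N11FibreChartSocketRecoordinatisation` §3 (sockets in canonical coordinates are
sockets at `fieldMeasure`, keyed to lit-balaban p28's `⊗_b coordMeasure η dU`).

WHY.  The chart seats compute in LEBESGUE coordinates on the Lie-algebra-valued bond fields (dag-n11-w6's δ-removal charts: reference `volume`; dag-n09-w2's
Euclidean engine: additive Haar measures), while FILE 4 §3 presents `fieldMeasure` by p28's `⊗_b coordMeasure η dU`, where per bond
`coordMeasure η dU = σ₀ • (η|_Ω).withDensity |det jac|` (p28).  THIS FILE unfolds the finite product: `⊗_b coordMeasure = σ₀^{#bonds} • ((⊗_b η)|_{Ω^{bonds}}).withDensity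
(A ↦ ∏_b |det jac (A b)|)` — [16] (18) «∫dA′↾Ω₁ Π_b σ(A′(b)) dA′(b)» as ONE weighted, windowed Lebesgue measure — so FILE 4 §1∕§2 (`M' := …`, `j := …`) apply verbatim to
Lebesgue-coordinate sockets.

WHAT THIS FILE PROVES (0 `def`, 0 `sorry`).
* §1 generic finite products: `lintegral_fintype_prod_eq_prod` (`∫⁻ ∏ᵢ fᵢ(xᵢ) d(⊗ μᵢ) = ∏ᵢ ∫⁻ fᵢ dμᵢ`, any `Fintype` index, dependent carriers — the tree's
  `Literature.Probability.Distributions.lintegral_fin_nat_prod_eq_prod` transported along `MeasurableEquiv.piCongrLeft`), ★ `pi_withDensity`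
  (`⊗ᵢ (μᵢ.withDensity fᵢ) = (⊗ᵢ μᵢ).withDensity (∏ᵢ fᵢ(xᵢ))`), `pi_smul_const` (`⊗ᵢ (c • μ) = c^{#ι} • ⊗ᵢ μ`), `pi_restrict_const` (`⊗ᵢ (μ|_s) = (⊗ᵢ μ)|_{sᶦ}`).
* §2 at p28's objects: ★★ `pi_coordMeasure_eq` — `⊗_b coordMeasure η dU = σ₀^{#β} • (((⊗_b η).restrict (pi univ Ω)).withDensity (A ↦ ∏_b jacDensity (A b)))`;
  ★★ `fieldMeasure_eq_map_expChart_lebesgue_alcove` — FILE 4's S1 presentation with the left side unfolded: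
  `(σ₀^{#bonds} • (((⊗_b η)|_{Ω^{bonds}}).withDensity ∏_b |det jac|)).map Θ = fieldMeasure P j (SU N)`; and FILE 4 §3's two socket faces re-keyed to that
  weighted, windowed Lebesgue measure: ★★ `socket_fieldMeasure_of_socket_lebesgue_alcove_fine ∕ _coarse`.

NOT IN THIS FILE: `σ₀`, `|det jac|` evaluated (p28 `coordMeasure_eq_withDensity_prod_sinc`, `sigma0`); any chart of Bałaban's; the socket (dag-n11-d).

HONEST FRAMING.  Helper lane of K1⁷, count-neutral; [folklore] measure theory (`Measure.pi_eq`, `Measure.restrict_pi_pi`, `withDensity_apply`, the tree's Fin-indexed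
Tonelli product) + lit-balaban p28 BY NAME; nothing of Bałaban's asserted beyond p28's landed (13)∕(18); (B4) ∕ (S-α) NOT closed; no registered stub proved; N11 NOT
discharged; K1⁷ NOT closed; counts unmoved (typed 28∕28 · discharged 5∕27).  One finite four-torus programme at fixed `ε = L^{−K}`; R4 closes only the conditional
finite-𝕋⁴ rung `BalabanLadder.UV` — NOT ℝ⁴, NOT OS, NOT a mass gap, NOT Clay.  No `sorry`, `axiom`, `def`, `instance`, `notation`.  Sources (SHAPE only): [16] (13),
(18) p.260.
-/

noncomputable section

open MeasureTheory ProbabilityTheory Set Filter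
open scoped ENNReal NNReal Matrix.Norms.L2Operator

namespace Summit.QuantumFields.YangMills.Theorems.BalabanUVNodesN11CoordMeasureProductAlcove

open Literature.MathematicalPhysics.QuantumFieldTheory.Balaban1983to89
open BalabanUVNodesN11FibreChartSocketRecoordinatisation (fieldMeasure_eq_map_pi_expChart)

/-! ## §1  Finite products: Tonelli product, `withDensity`, scalars, restriction -/

section Pi

variable {ι : Type*} [Fintype ι] {E : ι → Type*} [∀ i, MeasurableSpace (E i)]

/-- **Tonelli for a finite product of coordinate functions**, any `Fintype` index and dependent carriers:
`∫⁻ ∏ᵢ fᵢ(xᵢ) d(⊗ μᵢ) = ∏ᵢ ∫⁻ fᵢ dμᵢ` (the tree's `Fin`-indexed `lintegral_fin_nat_prod_eq_prod` along `MeasurableEquiv.piCongrLeft`). -/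
theorem lintegral_fintype_prod_eq_prod (μ : (i : ι) → Measure (E i)) [∀ i, SigmaFinite (μ i)]
    (f : (i : ι) → E i → ℝ≥0∞) (hf : ∀ i, Measurable (f i)) :
    ∫⁻ x, ∏ i, f i (x i) ∂(Measure.pi μ) = ∏ i, ∫⁻ x, f i x ∂(μ i) := by
  let e := (Fintype.equivFin ι).symm
  rw [← (measurePreserving_piCongrLeft μ e).lintegral_comp_emb (MeasurableEquiv.measurableEmbedding _)]
  simp_rw [← e.prod_comp, MeasurableEquiv.piCongrLeft_apply_apply]
  exact Literature.Probability.Distributions.lintegral_fin_nat_prod_eq_prod (fun i' => μ (e i')) (fun i' => f (e i'))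
    fun i' => hf _

/-- ★ **A finite product of measures with densities is the product measure with the product density**:
`⊗ᵢ (μᵢ.withDensity fᵢ) = (⊗ᵢ μᵢ).withDensity (x ↦ ∏ᵢ fᵢ (xᵢ))` (`Measure.pi_eq` + `restrict_pi_pi` + the Tonelli product). -/
theorem pi_withDensity (μ : (i : ι) → Measure (E i)) [∀ i, SigmaFinite (μ i)] (f : (i : ι) → E i → ℝ≥0∞)
    (hf : ∀ i, Measurable (f i)) [∀ i, SigmaFinite ((μ i).withDensity (f i))] :
    Measure.pi (fun i => (μ i).withDensity (f i)) = (Measure.pi μ).withDensity fun x => ∏ i, f i (x i) := by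
  refine Measure.pi_eq fun s hs => ?_
  rw [withDensity_apply _ (MeasurableSet.univ_pi hs), Measure.restrict_pi_pi,
    lintegral_fintype_prod_eq_prod _ _ hf]
  exact Finset.prod_congr rfl fun i _ => (withDensity_apply _ (hs i)).symm

/-- `⊗ᵢ (c • μᵢ) = c^{#ι} • ⊗ᵢ μᵢ` for a constant `c : ℝ≥0` (the `ℝ≥0`-action on measures). -/
theorem pi_smul_const (μ : (i : ι) → Measure (E i)) [∀ i, SigmaFinite (μ i)] (c : ℝ≥0) :
    Measure.pi (fun i => c • μ i) = (c ^ Fintype.card ι) • Measure.pi μ := by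
  refine Measure.pi_eq fun s _ => ?_
  rw [Measure.coe_nnreal_smul_apply, Measure.pi_pi, ENNReal.coe_pow, ← Finset.card_univ, ← Finset.prod_const,
    ← Finset.prod_mul_distrib]
  exact Finset.prod_congr rfl fun i _ => by rw [Measure.coe_nnreal_smul_apply]

end Pi

/-! ## §2  At lit-balaban p28's objects: `⊗_b coordMeasure` is Lebesgue-with-density on the product alcove; S1 in Lebesgue coordinates -/

section CoordMeasure

open HaarDensitySpecialUnitaryGlobal HaarExponentialChart SpecialUnitaryAlcove T4Continuum

variable {N : ℕ} [NeZero N]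
variable [MeasurableSpace (specialUnitaryLogChart (Fin N)).lie] [BorelSpace (specialUnitaryLogChart (Fin N)).lie]
  (η : Measure (specialUnitaryLogChart (Fin N)).lie) [η.IsAddHaarMeasure]

/-- ★★ **`⊗_b coordMeasure` UNFOLDED**: over a finite bond set `β`,
`⊗_b coordMeasure η dU = σ₀^{#β} • (((⊗_b η).restrict (pi univ (fun _ ↦ Ω))).withDensity (A ↦ ∏_b |det jac (A b)|))` — [16] (18)'s
«∫dA′↾Ω₁ Π_b σ(A′(b)) dA′(b)» as one weighted, windowed Lebesgue measure on the Lie-algebra-valued bond fields. -/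
theorem pi_coordMeasure_eq (β : Type*) [Fintype β] :
    (Measure.pi fun _ : β => coordMeasure η (HaarData.haar : Measure (Matrix.specialUnitaryGroup (Fin N) ℂ)))
      = (sigma0 η (HaarData.haar : Measure (Matrix.specialUnitaryGroup (Fin N) ℂ)) ^ Fintype.card β) •
        (((Measure.pi fun _ : β => η).restrict (Set.pi Set.univ fun _ => alcove (Fin N))).withDensity
          fun A => ∏ b, jacDensity (lie_adStable_specialUnitaryGroup (n := Fin N)) (A b)) := by
  haveI : (HaarData.haar : Measure (Matrix.specialUnitaryGroup (Fin N) ℂ)).IsHaarMeasure :=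
    Measure.isHaarMeasure_haarMeasure ⊤
  have hjac : Measurable (jacDensity (lie_adStable_specialUnitaryGroup (n := Fin N))) :=
    (continuous_jacDensity _).measurable
  -- per bond: `coordMeasure = σ₀ • (η|_Ω).withDensity |det jac|` (p28, definitional)
  have hcoord : coordMeasure η (HaarData.haar : Measure (Matrix.specialUnitaryGroup (Fin N) ℂ))
      = sigma0 η (HaarData.haar : Measure (Matrix.specialUnitaryGroup (Fin N) ℂ)) •
        (η.restrict (alcove (Fin N))).withDensity (jacDensity (lie_adStable_specialUnitaryGroup (n := Fin N))) := rfl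
  haveI : SigmaFinite ((η.restrict (alcove (Fin N))).withDensity
      (jacDensity (lie_adStable_specialUnitaryGroup (n := Fin N)))) := by
    haveI : IsFiniteMeasure ((η.restrict (alcove (Fin N))).withDensity
        (jacDensity (lie_adStable_specialUnitaryGroup (n := Fin N)))) :=
      isFiniteMeasure_withDensity (lintegral_jacDensity_alcove_ne_zero_and_ne_top η
        (HaarData.haar : Measure (Matrix.specialUnitaryGroup (Fin N) ℂ))).2
    infer_instance
  simp only [hcoord]
  rw [pi_smul_const, pi_withDensity _ _ (fun _ => hjac), Measure.restrict_pi_pi]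

/-- ★★ **S1 IN LEBESGUE COORDINATES**: the bondwise exponential chart carries the weighted, windowed Lebesgue measure
`σ₀^{#bonds} • (((⊗_b η)|_{Ω^{bonds}}).withDensity ∏_b |det jac (A b)|)` onto the product Haar measure `fieldMeasure P j (SU N)` (FILE 4's
`fieldMeasure_eq_map_pi_expChart` with `⊗_b coordMeasure` unfolded) — the presenting datum FILE 4 §1 (`M'`) ∕ §2 (`j`) consume for Lebesgue-coordinate sockets. -/
theorem fieldMeasure_eq_map_expChart_lebesgue_alcove (P : Params) (j : ℕ) :
    ((sigma0 η (HaarData.haar : Measure (Matrix.specialUnitaryGroup (Fin N) ℂ)) ^ Fintype.card (PBond P j)) •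
        (((Measure.pi fun _ : PBond P j => η).restrict (Set.pi Set.univ fun _ => alcove (Fin N))).withDensity
          fun A => ∏ b, jacDensity (lie_adStable_specialUnitaryGroup (n := Fin N)) (A b))).map
      (fun A : PBond P j → (specialUnitaryLogChart (Fin N)).lie =>
        fun b => (isChartRep_specialUnitaryGroup (n := Fin N)).expChart (A b))
      = fieldMeasure P j (Matrix.specialUnitaryGroup (Fin N) ℂ) := by
  rw [← pi_coordMeasure_eq η (PBond P j)]
  exact fieldMeasure_eq_map_pi_expChart η P j

/-- ★★ **S1 ON THE FINE SIDE, LEBESGUE COORDINATES**: a chart `Ψ'` into 𝔤-valued level-`j` bond fields pushing a reference `M` onto the weighted, windowed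
Lebesgue measure `σ₀^{#bonds} • (((⊗_b η)|_{Ω^{bonds}}).withDensity ∏_b |det jac|)` restricted to the pull-back of a measurable `S` is, composed with the bondwise
exponential chart, dag-n11-d's `hpush` at `fieldMeasure P j (SU N)` (FILE 4's `socket_fieldMeasure_of_socket_coordMeasure_fine` after `pi_coordMeasure_eq`). -/
theorem socket_fieldMeasure_of_socket_lebesgue_alcove_fine {Z : Type*} [MeasurableSpace Z] (M : Measure Z) (P : Params) (j : ℕ)
    {Ψ' : Z → (PBond P j → (specialUnitaryLogChart (Fin N)).lie)} (hΨ' : Measurable Ψ')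
    {S : Set (GaugeField P j (Matrix.specialUnitaryGroup (Fin N) ℂ))} (hS : MeasurableSet S)
    (hpush' : M.map Ψ' =
      ((sigma0 η (HaarData.haar : Measure (Matrix.specialUnitaryGroup (Fin N) ℂ)) ^ Fintype.card (PBond P j)) •
        (((Measure.pi fun _ : PBond P j => η).restrict (Set.pi Set.univ fun _ => alcove (Fin N))).withDensity
          fun A => ∏ b, jacDensity (lie_adStable_specialUnitaryGroup (n := Fin N)) (A b))).restrict
        ((fun A : PBond P j → (specialUnitaryLogChart (Fin N)).lie =>
            fun b => (isChartRep_specialUnitaryGroup (n := Fin N)).expChart (A b)) ⁻¹' S)) :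
    M.map ((fun A : PBond P j → (specialUnitaryLogChart (Fin N)).lie =>
        fun b => (isChartRep_specialUnitaryGroup (n := Fin N)).expChart (A b)) ∘ Ψ')
      = (fieldMeasure P j (Matrix.specialUnitaryGroup (Fin N) ℂ)).restrict S := by
  rw [← pi_coordMeasure_eq η (PBond P j)] at hpush'
  exact BalabanUVNodesN11FibreChartSocketRecoordinatisation.socket_fieldMeasure_of_socket_coordMeasure_fine η M P j hΨ' hS hpush'

/-- ★★ **S1 ON THE COARSE SIDE, LEBESGUE COORDINATES**: a socket identity computed with BASE the weighted, windowed Lebesgue measure on 𝔤-valued level-`j'`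
fields (fibre kernel read at the exponentiated field, Jacobian and chart composed with the bondwise exponential chart on the base coordinate) IS the socket
identity with base `fieldMeasure P j' (SU N)` (FILE 4's `socket_fieldMeasure_of_socket_coordMeasure_coarse` after `pi_coordMeasure_eq`). -/
theorem socket_fieldMeasure_of_socket_lebesgue_alcove_coarse {X β : Type*} [MeasurableSpace X] [MeasurableSpace β] (P : Params) (j' : ℕ)
    (κ : Kernel (GaugeField P j' (Matrix.specialUnitaryGroup (Fin N) ℂ)) X) [IsSFiniteKernel κ]
    {J : GaugeField P j' (Matrix.specialUnitaryGroup (Fin N) ℂ) × X → ℝ≥0∞} (hJ : Measurable J)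
    {Ψ : GaugeField P j' (Matrix.specialUnitaryGroup (Fin N) ℂ) × X → β} (hΨ : Measurable Ψ) {ν : Measure β} {S : Set β}
    (hpush' : ((((sigma0 η (HaarData.haar : Measure (Matrix.specialUnitaryGroup (Fin N) ℂ)) ^ Fintype.card (PBond P j')) •
        (((Measure.pi fun _ : PBond P j' => η).restrict (Set.pi Set.univ fun _ => alcove (Fin N))).withDensity
          fun A => ∏ b, jacDensity (lie_adStable_specialUnitaryGroup (n := Fin N)) (A b))) ⊗ₘ
          (κ.comap (fun A : PBond P j' → (specialUnitaryLogChart (Fin N)).lie =>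
              fun c => (isChartRep_specialUnitaryGroup (n := Fin N)).expChart (A c))
            (BalabanUVNodesN11FibreChartSocketRecoordinatisation.measurable_pi_expChart P j'))).withDensity
          (fun z => J (fun c => (isChartRep_specialUnitaryGroup (n := Fin N)).expChart (z.1 c), z.2))).map
        (fun z => Ψ (fun c => (isChartRep_specialUnitaryGroup (n := Fin N)).expChart (z.1 c), z.2)) = ν.restrict S) :
    (((fieldMeasure P j' (Matrix.specialUnitaryGroup (Fin N) ℂ)) ⊗ₘ κ).withDensity J).map Ψ = ν.restrict S := by
  rw [← pi_coordMeasure_eq η (PBond P j')] at hpush'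
  exact BalabanUVNodesN11FibreChartSocketRecoordinatisation.socket_fieldMeasure_of_socket_coordMeasure_coarse η P j' κ hJ hΨ hpush'

end CoordMeasure

end Summit.QuantumFields.YangMills.Theorems.BalabanUVNodesN11CoordMeasureProductAlcove
end
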